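import Mathlib
import Summits.Ventures.PercRepro2.LocRows
import Summits.Ventures.PercRepro2.SwRow
import Summits.Ventures.PercRepro2.SwOut
import Summits.Ventures.PercRepro2.SwAllRow
import Summits.Ventures.PercRepro2.SwOutAll
import Summits.Ventures.PercRepro2.SwOutArmFlip
import Summits.Ventures.PercRepro2.SwOutArms
import Summits.Ventures.PercRepro2.SwOutArmOrbit
import Summits.Ventures.PercRepro2.SwOutArmCube
import Summits.Ventures.PercRepro2.SwOutArmThm
import Summits.Ventures.PercRepro2.SwOutCoreDefs
import Summits.Ventures.PercRepro2.SwOutCoreHull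
import Summits.Ventures.PercRepro2.SwOutCoreDual
import Summits.Ventures.PercRepro2.SwOutCoreCube
import Summits.Ventures.PercRepro2.SwOutCoreKey
import Summits.Ventures.PercRepro2.SwOutShadowDefs
import Summits.Ventures.PercRepro2.SwOutShadowCube
import Summits.Ventures.PercRepro2.SwOutCoreShadowDefs
import Summits.Ventures.PercRepro2.SwOutCoreShadow
import Summits.Ventures.PercRepro2.SwOutCoreShadowFlip
import Summits.Ventures.PercRepro2.SwOutJunctionH1Defs
import Summits.Ventures.PercRepro2.SwOutJunctionH1Arms
import Summits.Ventures.PercRepro2.SwOutJunctionH1Cover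
import Summits.Ventures.PercRepro2.SwOutJunctionH1Inside
import Summits.Ventures.PercRepro2.SwOutJunctionH1Base
import Summits.Ventures.PercRepro2.SwOutCoreToggle
import Summits.Ventures.PercRepro2.SwOutCoreShadowArm
import Summits.Ventures.PercRepro2.SwOutCoreShadowKey
import Summits.Ventures.PercRepro2.SwOutCoreShadowUnion

/-!
# The coarse orbits through a core cube and its shadow cubes (blind cell PercRepro2, night-4
g14, 2026-08-26; proofs/NIGHT4-G14.md §4)

The coarse orbit of a shadow point of a one-sided point `ω₀` of a core base, and the coarse orbit
of a one-sided core point whose u-adjacent colouring is that of `ω₀` or its mirror, consist of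
shadow points of `ω₀` and core points of the base (`mem_orbit_shadowReal`,
`mem_orbit_coreReal_oneSided`): every orbit point is the flip of a union of coarse arms
(`SwOutCoreShadowUnion`), i.e. a far toggle after an optional flip of `sX`, and `flip sX`
exchanges the shadow points with the core points (`SwOutCoreShadowKey`, `SwOutCoreShadowFlip`).
When no arm is dropped the shadow points are core points (`shadowReal_eq_coreReal_of_no_drop`).
Also the hull at a blue-one-sided point (`hull_coreReal_oneSided_eq'`) and the canonical base of a
class point lies in the class (`coreBaseOf_mem_outClass`).
-/

namespace Summit.Ventures.PercRepro2

namespace LocRows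

open Hull

variable {V : Type*} {E : Type*} [Fintype E] [DecidableEq E]

open scoped Classical

variable {ends : E → Sym2 V}

section Orbit

variable {ι : Type*} {A : ι → Set V} {pure : ι → Prop} {ζ : Config E} {h u : V} {H : Set V}
  (hb : CoreBase ends ζ h u H A pure) {ω₀ : Config ι}
  (huR : uRed ends A u pure ω₀) (huB : ¬ uRed ends A u pure (flipAll ω₀))

/-- The shadow point with `X`-colour `c` and the far colouring of `ω`. -/
def shadowPt (ends : E → Sym2 V) (u : V) (A : ι → Set V) (c : Bool) (ω : Config ι) :
    Config (Option {i : ι // ¬ uAdjC ends u A i}) :=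
  fun j => Option.elim j c fun i => ω i.1

include hb huR huB

omit [DecidableEq E] in
/-- **The coarse orbit of a shadow point**: shadow points of the same one-sided point and core
points of the base. -/
theorem CoreBase.mem_orbit_shadowReal (hconn : ArmsConnected A ends)
    (ω' : Config (Option {i : ι // ¬ uAdjC ends u A i})) {ζ'' : Config E}
    (hζ'' : ζ'' ∈ orbit ends (allRed ends (shadowReal ends (sB ends u A ω₀) (sZ ends u A ω₀) none
      (shadowOf ends u A ω₀ ζ) ω') h) h) :
    (∃ ω'', ζ'' = shadowReal ends (sB ends u A ω₀) (sZ ends u A ω₀) none (shadowOf ends u A ω₀ ζ) ω'')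
      ∨ ∃ ω₁, ζ'' = coreReal ends A ζ ω₁ := by
  have hs := hb.shadowBase huR huB
  obtain ⟨p, hp⟩ := exists_armsUnion_of_mem_orbit (hs.coreFree_shadowReal ω') hζ''
  rw [flip_armsUnion_eq hb hconn (hb.hull_shadowReal_eq huR huB ω')] at hp
  by_cases hpX : p (sX ends u A ω₀)
  · rw [if_pos hpX, hb.flip_sX_shadowReal ω'] at hp
    unfold farSel at hp
    exact Or.inr ⟨_, hp.trans (hb.flip_armsSel_coreReal _ _)⟩
  · rw [if_neg hpX, ← shadowSel_far_eq, hs.flip_shadowSel_shadowReal] at hp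
    exact Or.inl ⟨_, hp⟩

omit [Fintype E] [DecidableEq E] in
/-- The hull at a blue-one-sided point: the mirror's `sX` with the far arms. -/
theorem CoreBase.hull_coreReal_oneSided_eq' {ω : Config ι}
    (hω : ∀ i, uAdjC ends u A i → ω i = toggle (uAdjC ends u A) ω₀ i) :
    hull ends (coreReal ends A ζ ω) h = {h} ∪ {x | ∃ j, x ∈ sB ends u A ω₀ j} := by
  have hω' : ∀ i, uAdjC ends u A i → flipAll ω i = ω₀ i := by
    intro i hi
    simp only [flipAll, hω i hi, toggle_apply_of_pos hi, Bool.not_not]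
  have huR' : uRed ends A u pure (flipAll ω) := (uRed_congr hω').2 huR
  have hω'' : ∀ i, uAdjC ends u A i → ω i = flipAll ω₀ i := by
    intro i hi
    simp only [flipAll, hω i hi, toggle_apply_of_pos hi]
  have huB' : ¬ uRed ends A u pure (flipAll (flipAll ω)) := by
    rw [flipAll_involutive ω]
    intro hu
    exact huB ((uRed_congr hω'').1 hu)
  rw [← hull_blue, hb.blue_coreReal, hb.dual.hull_coreReal_oneSided_eq huR' huB', sB_congr hω']

omit [DecidableEq E] in
/-- **The coarse orbit of a one-sided core point** (u-adjacent colouring that of `ω₀` or of its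
mirror): shadow points of `ω₀` and core points of the base. -/
theorem CoreBase.mem_orbit_coreReal_oneSided (hconn : ArmsConnected A ends) {ω : Config ι}
    (hω : (∀ i, uAdjC ends u A i → ω i = ω₀ i) ∨
      (∀ i, uAdjC ends u A i → ω i = toggle (uAdjC ends u A) ω₀ i))
    {ζ'' : Config E} (hζ'' : ζ'' ∈ orbit ends (allRed ends (coreReal ends A ζ ω) h) h) :
    (∃ ω'', ζ'' = shadowReal ends (sB ends u A ω₀) (sZ ends u A ω₀) none (shadowOf ends u A ω₀ ζ) ω'')
      ∨ ∃ ω₁, ζ'' = coreReal ends A ζ ω₁ := by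
  have hs := hb.shadowBase huR huB
  -- core-freeness and the hull
  have hcf : CoreFree ends (coreReal ends A ζ ω) h := by
    refine hb.coreFree_coreReal ?_
    rintro ⟨h1, h2⟩
    rcases hω with hω | hω
    · exact huB ((uRed_congr (flipAll_congr hω)).1 h2)
    · have hω' : ∀ i, uAdjC ends u A i → ω i = flipAll ω₀ i := by
        intro i hi
        simp only [flipAll, hω i hi, toggle_apply_of_pos hi]
      exact huB ((uRed_congr hω').1 h1)
  have hH : hull ends (coreReal ends A ζ ω) h = {h} ∪ {x | ∃ j, x ∈ sB ends u A ω₀ j} := by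
    rcases hω with hω | hω
    · rw [hb.hull_coreReal_oneSided_eq ((uRed_congr hω).2 huR) (fun hu =>
        huB ((uRed_congr (flipAll_congr hω)).1 hu)), sB_congr hω]
    · exact hb.hull_coreReal_oneSided_eq' huR huB hω
  obtain ⟨p, hp⟩ := exists_armsUnion_of_mem_orbit hcf hζ''
  rw [flip_armsUnion_eq hb hconn hH] at hp
  by_cases hpX : p (sX ends u A ω₀)
  · rw [if_pos hpX] at hp
    -- `flip sX` of the core point is a shadow point
    have key : ∃ ω'', flip ends (sX ends u A ω₀) (coreReal ends A ζ ω) =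
        shadowReal ends (sB ends u A ω₀) (sZ ends u A ω₀) none (shadowOf ends u A ω₀ ζ) ω'' := by
      rcases hω with hω | hω
      · exact ⟨shadowPt ends u A false ω,
          (hb.shadowReal_eq_flip_coreReal_false ω hω (shadowPt ends u A false ω) rfl
            (fun i => rfl)).symm⟩
      · refine ⟨shadowPt ends u A true (toggle (uAdjC ends u A) ω), ?_⟩
        have hω₂ : ∀ i, uAdjC ends u A i → toggle (uAdjC ends u A) ω i = ω₀ i := by
          intro i hi
          rw [toggle_apply_of_pos hi, hω i hi, toggle_apply_of_pos hi, Bool.not_not]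
        have e1 : coreReal ends A ζ ω = flip ends (sX ends u A ω₀ ∪ sZ ends u A ω₀)
            (coreReal ends A ζ (toggle (uAdjC ends u A) ω)) := by
          rw [hb.flip_sXZ_coreReal ω₀, toggle_toggle]
        rw [hb.shadowReal_eq_flip_coreReal_true (toggle (uAdjC ends u A) ω) hω₂
          (shadowPt ends u A true (toggle (uAdjC ends u A) ω)) rfl (fun i => rfl),
          flip_comm (sX ends u A ω₀ ∪ sZ ends u A ω₀), ← e1]
    obtain ⟨ω'', hω''⟩ := key
    rw [hω'', ← shadowSel_far_eq, hs.flip_shadowSel_shadowReal] at hp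
    exact Or.inl ⟨_, hp⟩
  · rw [if_neg hpX] at hp
    unfold farSel at hp
    exact Or.inr ⟨_, hp.trans (hb.flip_armsSel_coreReal _ _)⟩

omit [Fintype E] [DecidableEq E] huR huB in
/-- **Without a dropped arm the shadow points are core points.** -/
theorem CoreBase.shadowReal_eq_coreReal_of_no_drop (hZ : ∀ i, uAdjC ends u A i → ω₀ i = true)
    (ω' : Config (Option {i : ι // ¬ uAdjC ends u A i})) :
    ∃ ω₁, shadowReal ends (sB ends u A ω₀) (sZ ends u A ω₀) none (shadowOf ends u A ω₀ ζ) ω' =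
      coreReal ends A ζ ω₁ := by
  have hσ : shadowOf ends u A ω₀ ζ = ζ := by
    funext e
    apply shadowOf_apply_of_not
    rintro ⟨z, ⟨i, hi, hωi, _⟩, _⟩
    rw [hZ i hi] at hωi
    exact absurd hωi (by decide)
  have hζ : ζ = coreReal ends A ζ (fun _ => true) := (CoreBase.coreReal_top (A := A)).symm
  have e2 : flip ends (sX ends u A ω₀ ∪ sZ ends u A ω₀) ζ =
      coreReal ends A ζ (toggle (uAdjC ends u A) fun _ => true) := by
    conv_lhs => rw [hζ]
    exact hb.flip_sXZ_coreReal ω₀ _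
  unfold shadowReal
  rw [hσ, shadowFalse_eq, CoreBase.farFalse_eq_armsSel]
  cases hn : ω' none with
  | false =>
    have hset : {x | false = false ∧ x ∈ sX ends u A ω₀ ∪ sZ ends u A ω₀} =
        sX ends u A ω₀ ∪ sZ ends u A ω₀ := by
      ext x; simp
    rw [hset, flip_union_of_not_both (fun e h1 h2 => by
        rw [← CoreBase.farFalse_eq_armsSel] at h1
        exact hb.not_touches_far_sXZ ω' e h1 h2), e2, hb.flip_armsSel_coreReal]
    exact ⟨_, rfl⟩
  | true =>
    have hset : {x | true = false ∧ x ∈ sX ends u A ω₀ ∪ sZ ends u A ω₀} = (∅ : Set V) := by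
      ext x; simp
    rw [hset, Set.union_empty]
    have e3 : flip ends (armsSel A fun i => ∃ hi : ¬ uAdjC ends u A i, ω' (some ⟨i, hi⟩) = false) ζ =
        coreReal ends A ζ (toggle (fun i => ∃ hi : ¬ uAdjC ends u A i, ω' (some ⟨i, hi⟩) = false)
          fun _ => true) := by
      conv_lhs => rw [hζ]
      exact hb.flip_armsSel_coreReal _ _
    exact ⟨_, e3⟩

end Orbit

section Class

variable {U : Set V} {ξ : Config E} {h u : V}

/-- **The canonical base of a class point of the core kind lies in the class** (when it is a core
base on the arms). -/
theorem coreBaseOf_mem_outClass {ζ : Config E} (hcl : ζ ∈ outClass ends U h ξ)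
    (hk : CoreKind ends U h u ζ) {ι : Type*} {A : ι → Set V} {pure : ι → Prop}
    (hb : CoreBase ends (coreBaseOf ends ζ h u) h u (extHull ends ζ h u) A pure) :
    coreBaseOf ends ζ h u ∈ outClass ends U h ξ := by
  have hHU : extHull ends ζ h u ⊆ U := by
    intro x hx
    rcases hx with hx | hx
    · exact (mem_outClass.1 hcl).2 hx
    · exact hk.2 hx
  rw [mem_outClass] at hcl ⊢
  refine ⟨fun e he => ?_, ?_⟩
  · unfold coreBaseOf
    rw [flip_apply_of_notMem, hcl.1 e he]
    intro h'
    apply he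
    refine touches_mono ?_ h'
    intro x hx
    exact hHU (blueExt_subset_extHull hx)
  · have := hb.hull_coreReal_subset (fun _ => true)
    rw [CoreBase.coreReal_top] at this
    exact this.trans hHU

end Class

end LocRows

end Summit.Ventures.PercRepro2
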